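import Summits.Ventures.QEC.Census.CertCoverBatch
import Summits.Ventures.QEC.Census.BB.A1s_n180_k8_5acd1693.CoreDefs
import HarnessLib

set_option Elab.async false
set_option maxRecDepth 200000

/-!
# `[[180,8,16]]` one-level cover certificate of `A1s_n180_k8_5acd1693` — LEVEL-1→0 coset problems 217…228 (deep problems [0] excluded: `ProbDeep*.lean`) as COMPACT data
(`ProbData`: U, f, σ, y₀, allow; qec-type-10 `CertCoverBatch.mkCoset` rebuilds each `CosetProb` in the kernel) + their verdict
`probsOK cov covR hx hx1 D1 lxd 14` (one `decide +kernel`; 12 problems, depths f=0:12 f=1:0 f=2:0 f=3:0, est. 42.0 s).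
qec-search-1 g5 (pattern of search-9 g5 `Probs*`); data from JSON `level10.problems` (sha256 8e77f78e1d36236a…). Data + decided check; KERNEL.
-/

namespace Summit.Ventures.QEC.Census.A1s_n180_k8_5acd1693

open Matrix Summit.Ventures.QEC.Census Literature.InformationTheory.QuantumCodes

/-- Problems 217…228 (12): `⟨U, f, σ, y₀, allow⟩`. -/
def probs05 : List ProbData := [
    ⟨1211292479551004100600328, 0, 1099579474433, 4612002677776671808, []⟩,
    ⟨1211296514775170721456648, 0, 76481025, 316659349152832, []⟩,
    ⟨1211296839034412611076616, 0, 68795450881, 612806277391541312, []⟩,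
    ⟨1212476962139930548506920, 0, 36675256621, 1180735911827452291840, []⟩,
    ⟨1223840156489341974089984, 0, 43474223365, 1213804983422125388692000, []⟩,
    ⟨1360355430616823890968648, 0, 2203729797211, 1208926107950592936648384, []⟩,
    ⟨1360355431109404965995608, 0, 2203595580537, 1208926109006123965094592, []⟩,
    ⟨2422611479214718353147907, 0, 470829158, 2422611476786996344480859, []⟩,
    ⟨2424953925089101587948616, 0, 73417622633, 2422592452456206267596424, []⟩,
    ⟨2436907164173220448355328, 0, 108180062273, 2436888717429112110613393, []⟩,
    ⟨2447680313295343229870088, 0, 86881337371, 20070345888142574231168, []⟩,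
    ⟨2447680313787924304897048, 0, 86747120697, 20070346943673602677376, []⟩]

set_option maxHeartbeats 400000000 in
/-- Every problem of this chunk passes (`mkCoset` elimination + `cosetOKD` + fast `σ` + depth + `BU`-evenness + label checks). -/
theorem probs05_ok : probsOK A1s_n180_k8_5acd1693.cov covR hx hx1 D1 lxd 14 probs05 = true := by
  decide +kernel

/-- Pointwise form. -/
theorem probs05_all : ∀ x ∈ A1s_n180_k8_5acd1693.probs05, probOK cov covR hx hx1 D1 lxd 14 x = true := by
  have h := probs05_ok
  rwa [probsOK, List.all_eq_true] at h

end Summit.Ventures.QEC.Census.A1s_n180_k8_5acd1693
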